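import Literature.AlgebraicGeometry.HodgeTheory.FermatClaimPermutationInvariance
import Literature.AlgebraicGeometry.HodgeTheory.FermatAokiStandardCharacter
import Literature.AlgebraicGeometry.HodgeTheory.ShiodaClaimPairedProofs
import HarnessLib

/-!
# The "up to permutation" facts of `FermatInductiveClaims` from their literal printed forms

Family `hodge`, layer `Literature/AlgebraicGeometry/HodgeTheory`. Proof file (everything PROVED, no
named fact introduced) completing, for the three remaining engines of `FermatInductiveClaims`, what
`Aoki1987_claim_juxtaposition_of_append` (`FermatClaimPermutationInvariance`) does for Thm. 1-4 (i):
the named facts are rendered UP TO PERMUTATION of the coordinates (`univ.val.map σ = …`,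
`IsPaired δ` for an arbitrary fixed-point-free involution) — the form in which Aoki uses them
("`α ∼ β` if `α` is equal to `β` up to permutation", p. 387; da Silva's (P1)/(P2)) — whereas the
printed cycles live in literal coordinates: Shioda's linear space
`L : x_{2i} + ε x_{2i+1} = 0` represents `δ = (a₀, -a₀, …, a_r, -a_r)` (Thm. 1-1), Aoki's `Y` of
(2.1) represents `σ_{p,a} = (a, a + d, …, a + (p-1)d, -pa)` (Thm. 2-1), and Thm. 1-4 (ii) cancels a
literal juxtaposed `δ ∈ 𝔇ₘ`. Since claim(α) depends only on the multiset of values of `α`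
(`FermatCharacter.Claim.of_univ_val_map_eq`, `FermatCharacter.Claim.comp_perm`: the symmetric group
acts on `Xⁿₘ`), each rendered fact follows from its literal form:

* `FermatCharacter.standardPaired a = (a₀, -a₀, a₁, -a₁, …, a_r, -a_r)` (Aoki's element of `𝔇ⁿₘ`,
  pp. 386–387; index `2j ↦ a_j`, `2j + 1 ↦ -a_j`), `standardPaired_pairIndex_zero/one`,
  `FermatCharacter.isPaired_standardPaired`, and the structure lemma
  `FermatCharacter.IsPaired.exists_eq_standardPaired_comp` — **every paired character is
  `(a₀, -a₀, …, a_r, -a_r)` up to a permutation of the coordinates** (enumerate the `r + 1` orbits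
  `{i, σ i}`, `i < σ i`, of the pairing; `card_filter_lt_perm` of `ShiodaClaimPairedProofs`);
* `Shioda_claim_paired_of_standardPaired` — `Shioda_claim_paired` ⇐ claim(`(a₀, -a₀, …, a_r, -a_r)`)
  for all `aⱼ ≠ 0` (Thm. 1-1 as printed);
* `Aoki1987_claim_pStandard_of_aokiStandard` — `Aoki1987_claim_pStandard` ⇐ claim(`σ_{p,a}`) for the
  explicit character `FermatCharacter.aokiStandard` (Thm. 2-1 as printed; the multiset identity is
  `FermatCharacter.univ_val_map_aokiStandard` of `FermatAokiStandardCharacter`);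
* `Aoki1987_claim_of_claim_juxtaposition_paired_of_append` — Thm. 1-4 (ii) up to permutation ⇐ its
  literal form `claim(α ∗ (a₀, -a₀, …, a_t, -a_t)) ⟹ claim(α)`.

## References

* [Aoki1987] N. Aoki, Some new algebraic cycles on Fermat varieties, J. Math. Soc. Japan 39 (1987)
  385–396: §1 pp. 386–387 (`𝔇ⁿₘ`, `δ = (a₀, -a₀, …, a_r, -a_r)`, `L`, "`∼`"), Thm. 1-1, Thm. 1-4
  (p. 388), Thm. 2-1 (p. 388) (text read, J-STAGE copy).
* [daSilva2021HodgeFermat] G. da Silva Jr., arXiv:2101.04739, §2 (P1)/(P2) ("`∼` means equality up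
  to permutation between factors").
* [Ran1980] Z. Ran, Cycles on Fermat hypersurfaces, Compositio Math. 42 (1980), Prop. 1.8 (i).
-/

noncomputable section

open Finset

namespace Literature.AlgebraicGeometry.HodgeTheory

namespace FermatCharacter

variable {m r : ℕ}

/-! ### The standard paired character `(a₀, -a₀, …, a_r, -a_r)` -/

/-- `2r + 2 = (r + 1)·2`: the coordinates of `X²ʳₘ` come in `r + 1` pairs. [folklore] -/
theorem two_mul_add_two_eq (r : ℕ) : 2 * r + 2 = (r + 1) * 2 := by ring

/-- The index `2j + b` (`j ≤ r`, `b ∈ {0, 1}`) of `Fin (2r + 2)`: the `b`-th member of the `j`-th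
pair of coordinates. [folklore] -/
def pairIndex (j : Fin (r + 1)) (b : Fin 2) : Fin (2 * r + 2) :=
  finCongr (two_mul_add_two_eq r).symm (finProdFinEquiv (j, b))

/-- `(j, b) ↦ 2j + b` as an equivalence `Fin (r + 1) × Fin 2 ≃ Fin (2r + 2)`. [folklore] -/
def pairIndexEquiv : Fin (r + 1) × Fin 2 ≃ Fin (2 * r + 2) :=
  finProdFinEquiv.trans (finCongr (two_mul_add_two_eq r).symm)

/-- `pairIndexEquiv (j, b) = pairIndex j b` (`rfl`). [folklore] -/
@[simp]
theorem pairIndexEquiv_apply (j : Fin (r + 1)) (b : Fin 2) :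
    (pairIndexEquiv (j, b) : Fin (2 * r + 2)) = pairIndex j b := rfl

/-- `pairIndex j b = 2j + b` as a natural number. [folklore] -/
theorem val_pairIndex (j : Fin (r + 1)) (b : Fin 2) : (pairIndex j b : ℕ) = 2 * j + b := by
  simp [pairIndex, finProdFinEquiv, mul_comm]
  ring

/-- **The standard paired character `(a₀, -a₀, a₁, -a₁, …, a_r, -a_r)`** of `X²ʳₘ` — Aoki's element
`δ = (a₀, -a₀, …, a_r, -a_r)` of `𝔇ⁿₘ` in its printed order of coordinates (coordinate `2j` is
`a_j`, coordinate `2j + 1` is `-a_j`), the character represented by Shioda's linear space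
`L : x_{2i} + ε x_{2i+1} = 0`. [cite: Aoki1987, §1 pp. 386–387 (𝔇ⁿₘ and Thm. 1-1)] -/
def standardPaired (a : Fin (r + 1) → ZMod m) : Fin (2 * r + 2) → ZMod m :=
  fun i ↦ if (pairIndexEquiv.symm i).2 = 0 then a (pairIndexEquiv.symm i).1 else -a (pairIndexEquiv.symm i).1

/-- Coordinate `2j` of `(a₀, -a₀, …)` is `a_j`. [cite: Aoki1987, §1 p. 386] -/
@[simp]
theorem standardPaired_pairIndex_zero (a : Fin (r + 1) → ZMod m) (j : Fin (r + 1)) :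
    standardPaired a (pairIndex j 0) = a j := by
  rw [standardPaired, ← pairIndexEquiv_apply, Equiv.symm_apply_apply]
  simp

/-- Coordinate `2j + 1` of `(a₀, -a₀, …)` is `-a_j`. [cite: Aoki1987, §1 p. 386] -/
@[simp]
theorem standardPaired_pairIndex_one (a : Fin (r + 1) → ZMod m) (j : Fin (r + 1)) :
    standardPaired a (pairIndex j 1) = -a j := by
  rw [standardPaired, ← pairIndexEquiv_apply, Equiv.symm_apply_apply]
  simp

/-- All coordinates of `(a₀, -a₀, …, a_r, -a_r)` are non-zero iff all `a_j` are. [folklore] -/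
theorem standardPaired_ne_zero {a : Fin (r + 1) → ZMod m} (ha : ∀ j, a j ≠ 0) (i : Fin (2 * r + 2)) :
    standardPaired a i ≠ 0 := by
  unfold standardPaired
  split_ifs
  · exact ha _
  · exact neg_ne_zero.mpr (ha _)

/-- **`(a₀, -a₀, …, a_r, -a_r)` is paired** by the involution `2j ↔ 2j + 1`.
[cite: Ran1980, Prop. 1.8 (i)] [cite: Aoki1987, §1 p. 386] -/
theorem isPaired_standardPaired (a : Fin (r + 1) → ZMod m) : IsPaired (standardPaired a) := by
  classical
  -- the involution `(j, b) ↦ (j, b + 1)` transported along `pairIndexEquiv`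
  let τ : Equiv.Perm (Fin (r + 1) × Fin 2) := Equiv.prodCongr (Equiv.refl _) (Equiv.addRight 1)
  refine ⟨(pairIndexEquiv.symm.trans τ).trans pairIndexEquiv, fun i ↦ ?_, fun i ↦ ?_, fun i ↦ ?_⟩
  · intro h
    have h' := congrArg pairIndexEquiv.symm h
    simp only [Equiv.trans_apply, Equiv.symm_apply_apply] at h'
    have h2 := congrArg Prod.snd h'
    simp only [τ, Equiv.prodCongr_apply, Prod.map_snd, Equiv.coe_addRight] at h2
    omega
  · simp only [Equiv.trans_apply, Equiv.symm_apply_apply]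
    have hττ : ∀ p : Fin (r + 1) × Fin 2, τ (τ p) = p := fun ⟨j, b⟩ ↦ by
      refine Prod.ext rfl ?_
      simp only [τ, Equiv.prodCongr_apply, Prod.map_snd, Equiv.coe_addRight]
      fin_cases b <;> rfl
    rw [hττ, Equiv.apply_symm_apply]
  · obtain ⟨⟨j, b⟩, rfl⟩ := pairIndexEquiv.surjective i
    simp only [Equiv.trans_apply, Equiv.symm_apply_apply, standardPaired, τ, Equiv.prodCongr_apply,
      Prod.map_fst, Prod.map_snd, Equiv.refl_apply, Equiv.coe_addRight]
    fin_cases b <;> simp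

/-- **Every paired character is `(a₀, -a₀, …, a_r, -a_r)` up to a permutation of the coordinates.**
If `δ ∘ σ = -δ` for a fixed-point-free involution `σ` of the `2r + 2` coordinates, enumerate the
`r + 1` smaller elements `i₀ < i₁ < ⋯` of the orbits `{i, σ i}` (`card_filter_lt_perm`); then
`(j, 0) ↦ i_j`, `(j, 1) ↦ σ i_j` is a bijection `Fin (r+1) × Fin 2 ≃ Fin (2r+2)` along which `δ`
reads `(δ_{i₀}, -δ_{i₀}, …)`. [cite: Aoki1987, §1 pp. 386–387 ("δ ∼ (a₀, -a₀, …, a_r, -a_r)")]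
[cite: Ran1980, Prop. 1.8 (i)] -/
theorem IsPaired.exists_eq_standardPaired_comp {δ : Fin (2 * r + 2) → ZMod m} (h : IsPaired δ) :
    ∃ (a : Fin (r + 1) → ZMod m) (π : Equiv.Perm (Fin (2 * r + 2))), δ = standardPaired a ∘ π := by
  classical
  obtain ⟨σ, h1, h2, hδ⟩ := h
  -- the smaller elements of the orbits and their enumeration
  set R : Finset (Fin (2 * r + 2)) := {i | i < σ i} with hR
  have hcard : Fintype.card R = r + 1 := by rw [Fintype.card_coe, hR, card_filter_lt_perm h1 h2]
  let e : R ≃ Fin (r + 1) := Fintype.equivFinOfCardEq hcard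
  let rep : Fin (r + 1) → Fin (2 * r + 2) := fun j ↦ (e.symm j).1
  have hrep : ∀ j, rep j < σ (rep j) := fun j ↦ by
    have := (e.symm j).2
    simp only [hR, Finset.mem_filter, Finset.mem_univ, true_and] at this
    exact this
  have hrep_inj : Function.Injective rep := fun j j' hjj' ↦
    e.symm.injective (Subtype.ext hjj')
  -- the bijection `(j, 0) ↦ rep j`, `(j, 1) ↦ σ (rep j)`
  let f : Fin (r + 1) × Fin 2 → Fin (2 * r + 2) := fun p ↦ if p.2 = 0 then rep p.1 else σ (rep p.1)
  have hf_inj : Function.Injective f := by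
    rintro ⟨j, b⟩ ⟨j', b'⟩ hjj'
    fin_cases b <;> fin_cases b'
    · simp only [f, Fin.zero_eta, Fin.isValue, ↓reduceIte] at hjj'
      simp [hrep_inj hjj']
    · simp only [f, Fin.zero_eta, Fin.isValue, ↓reduceIte, Fin.mk_one, one_ne_zero] at hjj'
      -- `rep j = σ (rep j')` contradicts `rep j < σ (rep j)` and `rep j' < σ (rep j')`
      exfalso
      have ha := hrep j
      have hb := hrep j'
      rw [hjj', h2] at ha
      exact lt_asymm ha hb
    · simp only [f, Fin.mk_one, Fin.isValue, one_ne_zero, ↓reduceIte, Fin.zero_eta] at hjj'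
      exfalso
      have ha := hrep j
      have hb := hrep j'
      rw [← hjj', h2] at hb
      exact lt_asymm ha hb
    · simp only [f, Fin.mk_one, Fin.isValue, one_ne_zero, ↓reduceIte] at hjj'
      simp [hrep_inj (σ.injective hjj')]
  have hf_bij : Function.Bijective f := by
    refine (Fintype.bijective_iff_injective_and_card f).mpr ⟨hf_inj, ?_⟩
    simp only [Fintype.card_prod, Fintype.card_fin]
    ring
  let E : Fin (r + 1) × Fin 2 ≃ Fin (2 * r + 2) := Equiv.ofBijective f hf_bij
  refine ⟨fun j ↦ δ (rep j), (E.symm.trans pairIndexEquiv), funext fun i ↦ ?_⟩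
  -- evaluate both sides at `i = E (j, b)`
  obtain ⟨⟨j, b⟩, rfl⟩ := E.surjective i
  simp only [Function.comp_apply, Equiv.trans_apply, Equiv.symm_apply_apply, standardPaired]
  fin_cases b
  · show δ (f (j, 0)) = δ (rep j)
    simp [f]
  · show δ (f (j, 1)) = -δ (rep j)
    simp [f, hδ]

end FermatCharacter

/-! ### Thm. 1-1 up to permutation from its literal form -/

/-- **`Shioda_claim_paired` follows from its literal printed form** — claim(`(a₀, -a₀, …, a_r, -a_r)`)
for all `a_j ≠ 0` ("THEOREM 1-1 (Shioda). The linear space `L [: x_{2i} + ε x_{2i+1} = 0]`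
represents `δ [= (a₀, -a₀, …, a_r, -a_r)]`" with "represents ⟹ claim", p. 386): a paired
character is `(a₀, -a₀, …) ∘ π` (`IsPaired.exists_eq_standardPaired_comp`) and claim is invariant
under permutations of the coordinates (`FermatCharacter.Claim.comp_perm`).
[cite: Aoki1987, Thm. 1-1 and §1 pp. 386–387] -/
theorem Shioda_claim_paired_of_standardPaired
    (h : ∀ (m r : ℕ) [NeZero m] (a : Fin (r + 1) → ZMod m), (∀ j, a j ≠ 0) →
      FermatCharacter.Claim m r (FermatCharacter.standardPaired a)) :
    Shioda_claim_paired := by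
  intro m r _ δ hδ hpair
  obtain ⟨a, π, rfl⟩ := hpair.exists_eq_standardPaired_comp
  refine (h m r a fun j hj ↦ ?_).comp_perm π
  refine hδ (π.symm (FermatCharacter.pairIndex j 0)) ?_
  rw [Function.comp_apply, Equiv.apply_symm_apply, FermatCharacter.standardPaired_pairIndex_zero, hj]

/-! ### Thm. 2-1 up to permutation from its literal form -/

/-- **`Aoki1987_claim_pStandard` follows from its literal printed form** — claim(`σ_{p,a}`) for the
explicit character `σ_{p,a} = (a, a + d, …, a + (p-1)d, -pa)` (`FermatCharacter.aokiStandard`,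
Aoki's order of coordinates; "THEOREM 2-1. The variety `Y` defined by (2.1) … represents the class
`α [= σ_{p,a}]`"): a character with the multiset of values of `σ_{p,a}`
(`FermatCharacter.univ_val_map_aokiStandard`) has the same claim
(`FermatCharacter.Claim.of_univ_val_map_eq`). [cite: Aoki1987, Thm. 2-1 (p. 388) and §1 p. 387] -/
theorem Aoki1987_claim_pStandard_of_aokiStandard
    (h : ∀ (m r : ℕ) [NeZero m], (2 * r + 1).Prime → 2 * r + 1 ∣ m → 2 < m / (2 * r + 1) →
      ∀ a : ZMod m, Nat.Coprime a.val (m / (2 * r + 1)) →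
        FermatCharacter.Claim m r (FermatCharacter.aokiStandard r m a)) :
    Aoki1987_claim_pStandard := by
  intro m p r _ hp hpr hpm hd a ha σ hσ
  subst hpr
  exact FermatCharacter.Claim.of_univ_val_map_eq
    (hσ.trans (FermatCharacter.univ_val_map_aokiStandard r m a).symm) (h m r hp hpm hd a ha)

/-! ### Thm. 1-4 (ii) up to permutation from its literal form -/

/-- **`Aoki1987_claim_of_claim_juxtaposition_paired` follows from its literal printed form** —
"(ii) If there exists `δ ∈ 𝔇ₘ` such that claim(`α∗δ`) is true, then claim(α) is also true" with
`δ = (a₀, -a₀, …, a_t, -a_t)` literally juxtaposed (`FermatCharacter.append α (standardPaired a)`):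
given `γ` with `univ.val.map γ = univ.val.map α + univ.val.map δ`, `δ` paired with all `δᵢ ≠ 0`,
write `δ = (a₀, -a₀, …) ∘ π` (`IsPaired.exists_eq_standardPaired_comp`), so that
`γ ∼ α ∗ (a₀, -a₀, …)` and claim(γ) gives claim(`α ∗ (a₀, -a₀, …)`)
(`FermatCharacter.Claim.of_univ_val_map_eq`). [cite: Aoki1987, Thm. 1-4 (ii), p. 388] -/
theorem Aoki1987_claim_of_claim_juxtaposition_paired_of_append
    (h : ∀ (m r t : ℕ) [NeZero m] (α : Fin (2 * r + 2) → ZMod m) (a : Fin (t + 1) → ZMod m),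
      FermatCharacter.IsHodge α → (∀ j, a j ≠ 0) →
      FermatCharacter.Claim m (r + t + 1) (FermatCharacter.append α (FermatCharacter.standardPaired a)) →
        FermatCharacter.Claim m r α) :
    Aoki1987_claim_of_claim_juxtaposition_paired := by
  intro m r t _ α δ γ hα hδ hpair hγ hclaim
  obtain ⟨a, π, rfl⟩ := hpair.exists_eq_standardPaired_comp
  have ha : ∀ j, a j ≠ 0 := fun j hj ↦ hδ (π.symm (FermatCharacter.pairIndex j 0)) (by
    rw [Function.comp_apply, Equiv.apply_symm_apply, FermatCharacter.standardPaired_pairIndex_zero, hj])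
  refine h m r t α a hα ha (FermatCharacter.Claim.of_univ_val_map_eq ?_ hclaim)
  rw [FermatCharacter.univ_val_map_append, hγ]
  congr 1
  classical
  rw [← Multiset.map_map (FermatCharacter.standardPaired a) π, Multiset.map_univ_val_equiv]

end Literature.AlgebraicGeometry.HodgeTheory

end
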